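import Literature.Geometry.ComplexHyperbolic.UnitBallQuotientManifold
import Literature.AlgebraicGeometry.ShimuraVarieties.UnitaryBallConeChart
import HarnessLib

/-!
# The framed (datum-free) ball chart of a negative cone: fibres, openness, equivariance, holomorphy

Namespace `Literature.AlgebraicGeometry.ShimuraVarieties.FramedCone`.
Definitions with bodies and theorems only; no named fact, no `sorry`.

The tree's cone-to-ball dictionary `UnitaryBallConeChart.lean` (BMM Part 2 §1.3: the ball is the space of negative
lines) is stated over a `UnitaryBallUniformisationDatum` — a structure whose fields INCLUDE the surface `X` and its
uniformisation.  This file re-does the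
dictionary over the BARE data it actually uses, so that it can be invoked while CONSTRUCTING `X`
(assembly `ShimuraVarieties/BallQuotientUniformisedOf.lean`):

* § 1 (`Hc ∈ M₃(ℂ)` hermitian with a frame `T`, `Tᴴ Hc T = J = diag(1,1,-1)`): the chart
  `coneChart T hT : negCone Hc → 𝔹²`, `v ↦ proj (T⁻¹ v)` (`BallModel.proj`), its fibres (the punctured complex
  lines, `coneChart_eq_iff`), continuity, the section `coneLift` (`coneChart_coneLift`, surjectivity), OPENNESS
  (`isOpenMap_coneChart`: rescaled sections through every cone vector), equivariance `u • coneChart v =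
  coneChart (g v)` for `mat u = T⁻¹ g T` (`smul_coneChart`), and complex differentiability of the chart in
  coordinates (`coneChartVec`, `differentiableAt_coneChartVec`);
* § 2: holomorphy glue on the ball manifold of `UnitBallQuotientManifold.lean` (one chart = the inclusion
  `𝔹² ⊂ ℂ²`): a manifold-differentiable `k : 𝔹² → ℂ` is complex differentiable in coordinates
  (`differentiableAt_comp_ballChart_symm`, via Mathlib's `contMDiffOn_isOpenEmbedding_symm`);
* the arithmetic part (the lattice `T⁻¹ Γ^{τ₁} T = UnitaryGroup.archImageU21 … Γ` acting on the chart, the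
  projection `negCone → Δ\𝔹²` with its fibre description, and the holomorphy glue for it) is the sequel
  `FramedConeLattice.lean`.

References: N. Bergeron, J. Millson, C. Moeglin, Acta Math. 216 (2016), Introduction §1.1, Part 2 §§1.2–1.3;
A. Borel, H. Jacquet, Proc. Symp. Pure Math. 33.1 (1979) §4.1; W. Rudin, *Function Theory in the Unit Ball of ℂⁿ*
(1980) §2.2.  Everything below is PROVED.

Provenance: Literature home (namespace `Literature.AlgebraicGeometry.ShimuraVarieties.FramedCone`) of the Summits-side `HodgeConjecture/CorCM/Geometry/FramedConeChart` (imports `Literature/` and Mathlib only), re-homed so that the Literature named facts it proves are discharged Literature-side under their exact names. Lane `lit-hodgefound`, seat p20.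
-/

set_option autoImplicit false

noncomputable section

open scoped Manifold ContDiff Matrix _root_.Topology ComplexOrder
open Set Function MulAction Matrix NumberField
open Literature.Geometry.ComplexHyperbolic
open Literature.Geometry.ComplexHyperbolic.BallModel (U21 Ball Q proj lift mat x₀ nsq)
open Literature.AlgebraicGeometry.ShimuraVarieties (hermForm negCone mem_negCone_iff isOpen_negCone
  smul_mem_negCone signatureMatrix conjRingHom unitaryGroup mem_unitaryGroup_iff IsCongruenceSubgroup
  embedding_conjRingHom)

namespace Literature.AlgebraicGeometry.ShimuraVarieties.FramedCone

/-! ## 1. The X-free ball chart of the negative cone of a framed hermitian form -/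

section ConeChart

variable {Hc : Matrix (Fin 3) (Fin 3) ℂ} (T : GL (Fin 3) ℂ)
  (hT : (T : Matrix (Fin 3) (Fin 3) ℂ)ᴴ * Hc * (T : Matrix (Fin 3) (Fin 3) ℂ) = BallModel.J)

/-- The inverse frame matrix `T⁻¹`. [cite: BergeronMillsonMoeglin2016Balls, Part 2 §1.3, auxiliary construction] -/
abbrev ti : Matrix (Fin 3) (Fin 3) ℂ := ((T⁻¹ : GL (Fin 3) ℂ) : Matrix (Fin 3) (Fin 3) ℂ)

/-- `T T⁻¹ = 1`. [cite: Shafarevich1994, Book 3 Ch. IX §3.2, auxiliary step] -/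
theorem t_mul_ti : (T : Matrix (Fin 3) (Fin 3) ℂ) * ti T = 1 := by
  rw [ti, ← Units.val_mul, mul_inv_cancel, Units.val_one]

/-- `T⁻¹ T = 1`. [cite: Shafarevich1994, Book 3 Ch. IX §3.2, auxiliary step] -/
theorem ti_mul_t : ti T * (T : Matrix (Fin 3) (Fin 3) ℂ) = 1 := by
  rw [ti, ← Units.val_mul, inv_mul_cancel, Units.val_one]

include hT in
/-- `Hc = T⁻ᴴ J T⁻¹`. [cite: Shafarevich1994, Book 3 Ch. IX §3.2, auxiliary step] -/
theorem hc_eq : Hc = (ti T)ᴴ * BallModel.J * ti T := by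
  rw [← hT]
  calc Hc = ((T : Matrix (Fin 3) (Fin 3) ℂ) * ti T)ᴴ * Hc * ((T : Matrix (Fin 3) (Fin 3) ℂ) * ti T) := by
        rw [t_mul_ti]; simp
    _ = (ti T)ᴴ * ((T : Matrix (Fin 3) (Fin 3) ℂ)ᴴ * Hc * (T : Matrix (Fin 3) (Fin 3) ℂ)) * ti T := by
        rw [conjTranspose_mul]; simp only [Matrix.mul_assoc]

include hT in
/-- The form in the frame: `Q (T⁻¹ v) = vᴴ Hc v`. [cite: Shafarevich1994, Book 3 Ch. IX §3.2, auxiliary step] -/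
theorem Q_ti_mulVec (v : Fin 3 → ℂ) : ((Q (ti T *ᵥ v) : ℝ) : ℂ) = star v ⬝ᵥ (Hc *ᵥ v) := by
  rw [← BallModel.form_eq_Q, Literature.AlgebraicGeometry.ShimuraVarieties.ConeChart.star_mulVec_dotProduct,
    ← hc_eq T hT]

include hT in
/-- A vector of the negative cone of `Hc` is `J`-negative in the frame. [cite: Shafarevich1994, Book 3 Ch. IX §3.2, auxiliary step] -/
theorem Q_ti_mulVec_neg {v : Fin 3 → ℂ} (hv : v ∈ negCone Hc) : Q (ti T *ᵥ v) < 0 := by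
  have h := mem_negCone_iff.mp hv
  rwa [← Q_ti_mulVec T hT, Complex.ofReal_re] at h

/-- **The ball chart of the negative cone** `v ↦ proj (T⁻¹ v)` (BMM Part 2 §1.3: the ball is the space of
negative lines), over the bare data `(Hc, T)`. [cite: BergeronMillsonMoeglin2016Balls, Part 2 §1.3] -/
def coneChart (v : negCone Hc) : Ball :=
  proj (ti T *ᵥ (v : Fin 3 → ℂ)) (Q_ti_mulVec_neg T hT v.2)

/-- Coordinates of the chart. [cite: Shafarevich1994, Book 3 Ch. IX §3.2, auxiliary step] -/
theorem coneChart_val (v : negCone Hc) (i : Fin 2) :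
    (coneChart T hT v).1 i = (ti T *ᵥ (v : Fin 3 → ℂ)) (Fin.castSucc i) / (ti T *ᵥ (v : Fin 3 → ℂ)) 2 :=
  BallModel.proj_val _ _ i

/-- Fibres of the chart are the punctured complex lines: `coneChart v = coneChart w ↔ v ∈ ℂˣ w`.
 [cite: Shafarevich1994, Book 3 Ch. IX §3.2, auxiliary step] -/
theorem coneChart_eq_iff (v w : negCone Hc) :
    coneChart T hT v = coneChart T hT w ↔ ∃ c : ℂ, c ≠ 0 ∧ (v : Fin 3 → ℂ) = c • (w : Fin 3 → ℂ) := by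
  constructor
  · intro h
    have hprop := Literature.AlgebraicGeometry.ShimuraVarieties.UnitaryBallUniformisationDatum.eq_smul_of_proj_eq
      (Q_ti_mulVec_neg T hT v.2) (Q_ti_mulVec_neg T hT w.2) h
    refine ⟨(ti T *ᵥ (v : Fin 3 → ℂ)) 2 / (ti T *ᵥ (w : Fin 3 → ℂ)) 2,
      div_ne_zero (BallModel.ne_zero_of_Q_neg (Q_ti_mulVec_neg T hT v.2))
        (BallModel.ne_zero_of_Q_neg (Q_ti_mulVec_neg T hT w.2)), ?_⟩
    have := congrArg (fun u ↦ (T : Matrix (Fin 3) (Fin 3) ℂ) *ᵥ u) hprop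
    simpa only [mulVec_mulVec, t_mul_ti, one_mulVec, mulVec_smul] using this
  · rintro ⟨c, hc, hvw⟩
    apply BallModel.Ball.ext
    intro i
    rw [coneChart_val, coneChart_val, hvw, mulVec_smul, Pi.smul_apply, Pi.smul_apply, smul_eq_mul,
      smul_eq_mul, mul_div_mul_left _ _ hc]

/-- The chart is continuous. [cite: Shafarevich1994, Book 3 Ch. IX §3.2, auxiliary step] -/
theorem continuous_coneChart : Continuous (coneChart T hT) := by
  have hc : Continuous fun v : negCone Hc ↦ ti T *ᵥ (v : Fin 3 → ℂ) :=
    continuous_const.matrix_mulVec continuous_subtype_val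
  refine Continuous.subtype_mk (continuous_pi fun i ↦ ?_) _
  have h2 : ∀ v : negCone Hc, (ti T *ᵥ (v : Fin 3 → ℂ)) 2 ≠ 0 := fun v ↦
    BallModel.ne_zero_of_Q_neg (Q_ti_mulVec_neg T hT v.2)
  fin_cases i
  · exact ((continuous_apply 0).comp hc).div ((continuous_apply 2).comp hc) h2
  · exact ((continuous_apply 1).comp hc).div ((continuous_apply 2).comp hc) h2

include hT in
/-- The section vector `T (z₀, z₁, 1)` of a ball point lies in the negative cone. [cite: Shafarevich1994, Book 3 Ch. IX §3.2, auxiliary step] -/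
theorem t_mulVec_lift_mem (z : Ball) : (T : Matrix (Fin 3) (Fin 3) ℂ) *ᵥ lift z ∈ negCone Hc := by
  rw [mem_negCone_iff, ← Q_ti_mulVec T hT, mulVec_mulVec, ti_mul_t, one_mulVec, Complex.ofReal_re]
  exact BallModel.Q_lift z

/-- The continuous section `z ↦ T (z₀, z₁, 1)` of the chart. [cite: BergeronMillsonMoeglin2016Balls, Part 2 §1.3, auxiliary construction] -/
def coneLift (z : Ball) : negCone Hc := ⟨(T : Matrix (Fin 3) (Fin 3) ℂ) *ᵥ lift z, t_mulVec_lift_mem T hT z⟩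

/-- `coneChart (coneLift z) = z`. [cite: Shafarevich1994, Book 3 Ch. IX §3.2, auxiliary step] -/
theorem coneChart_coneLift (z : Ball) : coneChart T hT (coneLift T hT z) = z := by
  apply BallModel.Ball.ext
  intro i
  rw [coneChart_val]
  fin_cases i <;> simp [coneLift, mulVec_mulVec, BallModel.lift]

/-- The chart is surjective. [cite: Shafarevich1994, Book 3 Ch. IX §3.2, auxiliary step] -/
theorem coneChart_surjective : Surjective (coneChart T hT) := fun z ↦ ⟨coneLift T hT z, coneChart_coneLift T hT z⟩

/-- `BallModel.lift` is continuous. [cite: Shafarevich1994, Book 3 Ch. IX §3.2, auxiliary step] -/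
theorem continuous_ballLift : Continuous (BallModel.lift) := by
  refine continuous_pi fun k => ?_
  fin_cases k <;> simp [BallModel.lift]
  · exact (continuous_apply 0).comp continuous_subtype_val
  · exact (continuous_apply 1).comp continuous_subtype_val
  · exact continuous_const

/-- The rescaled section through a cone vector: `((T⁻¹ v)₂) • T (lift (coneChart v)) = v`. [cite: Shafarevich1994, Book 3 Ch. IX §3.2, auxiliary step] -/
theorem smul_t_mulVec_lift_coneChart (v : negCone Hc) :
    ((ti T *ᵥ (v : Fin 3 → ℂ)) 2) • ((T : Matrix (Fin 3) (Fin 3) ℂ) *ᵥ lift (coneChart T hT v)) = v := by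
  have h2 : (ti T *ᵥ (v : Fin 3 → ℂ)) 2 ≠ 0 := BallModel.ne_zero_of_Q_neg (Q_ti_mulVec_neg T hT v.2)
  unfold coneChart
  rw [Literature.AlgebraicGeometry.ShimuraVarieties.UnitaryBallUniformisationDatum.lift_proj, mulVec_smul,
    smul_smul, mul_inv_cancel₀ h2, one_smul, mulVec_mulVec, t_mul_ti, one_mulVec]

/-- **The cone chart is an open map** (it has a continuous local section through every cone vector).
 [cite: Shafarevich1994, Book 3 Ch. IX §3.2, auxiliary step] -/
theorem isOpenMap_coneChart : IsOpenMap (coneChart T hT) := by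
  intro U hU
  rw [isOpen_iff_mem_nhds]
  rintro z ⟨v, hvU, rfl⟩
  set c : ℂ := (ti T *ᵥ (v : Fin 3 → ℂ)) 2 with hc_def
  have hc : c ≠ 0 := BallModel.ne_zero_of_Q_neg (Q_ti_mulVec_neg T hT v.2)
  let s : Ball → negCone Hc := fun z' ↦
    ⟨c • ((T : Matrix (Fin 3) (Fin 3) ℂ) *ᵥ lift z'), smul_mem_negCone hc (t_mulVec_lift_mem T hT z')⟩
  have hs' : Continuous fun z' : Ball ↦ c • ((T : Matrix (Fin 3) (Fin 3) ℂ) *ᵥ lift z') :=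
    (continuous_const.matrix_mulVec continuous_ballLift).const_smul c
  have hs : Continuous s := hs'.subtype_mk _
  have hsv : s (coneChart T hT v) = v := Subtype.ext (smul_t_mulVec_lift_coneChart T hT v)
  have hsec : ∀ z', coneChart T hT (s z') = z' := by
    intro z'
    rw [← coneChart_coneLift T hT z']
    refine (coneChart_eq_iff T hT _ _).2 ⟨c, hc, ?_⟩
    rw [coneChart_coneLift]
    rfl
  refine Filter.mem_of_superset ((hU.preimage hs).mem_nhds ?_) ?_
  · show s (coneChart T hT v) ∈ U
    rwa [hsv]
  · intro z' hz'
    exact ⟨s z', hz', hsec z'⟩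

/-- **Equivariance of the cone chart**: if `u ∈ U(2,1)` has matrix `T⁻¹ g T` and `g v` is again in the cone,
then `u • coneChart v = coneChart (g v)`. [cite: BergeronMillsonMoeglin2016Balls, Part 2 §1.3] -/
theorem smul_coneChart (u : U21) {g : Matrix (Fin 3) (Fin 3) ℂ}
    (hu : mat u = ti T * g * (T : Matrix (Fin 3) (Fin 3) ℂ)) (v : negCone Hc)
    (hgv : g *ᵥ (v : Fin 3 → ℂ) ∈ negCone Hc) :
    u • coneChart T hT v = coneChart T hT ⟨g *ᵥ (v : Fin 3 → ℂ), hgv⟩ := by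
  have hv := Q_ti_mulVec_neg T hT v.2
  have h2 := BallModel.ne_zero_of_Q_neg hv
  rw [BallModel.smul_def, BallModel.act]
  unfold coneChart
  have hW : BallModel.W3 u (proj (ti T *ᵥ (v : Fin 3 → ℂ)) hv) =
      ((ti T *ᵥ (v : Fin 3 → ℂ)) 2)⁻¹ • (ti T *ᵥ (g *ᵥ (v : Fin 3 → ℂ))) := by
    rw [BallModel.W3, Literature.AlgebraicGeometry.ShimuraVarieties.UnitaryBallUniformisationDatum.lift_proj,
      mulVec_smul, hu, mulVec_mulVec, mulVec_mulVec, Matrix.mul_assoc (ti T * g), t_mul_ti, Matrix.mul_one]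
  simp only [hW]
  exact Literature.AlgebraicGeometry.ShimuraVarieties.UnitaryBallUniformisationDatum.proj_smul _ (inv_ne_zero h2) _

/-- The chart in coordinates, as a map `ℂ³ → ℂ²` (meaningful on the negative cone). [cite: BergeronMillsonMoeglin2016Balls, Part 2 §1.3, auxiliary construction] -/
def coneChartVec (v : Fin 3 → ℂ) : Fin 2 → ℂ :=
  ![(ti T *ᵥ v) 0 / (ti T *ᵥ v) 2, (ti T *ᵥ v) 1 / (ti T *ᵥ v) 2]

/-- On the cone, the coordinates of `coneChart v` are `coneChartVec v`. [cite: Shafarevich1994, Book 3 Ch. IX §3.2, auxiliary step] -/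
theorem coe_coneChart (v : negCone Hc) : ((coneChart T hT v).1 : Fin 2 → ℂ) = coneChartVec T v := by
  funext i
  rw [coneChart_val]
  fin_cases i <;> simp [coneChartVec]

include hT in
/-- The coordinate chart is complex differentiable at every cone vector. [cite: Shafarevich1994, Book 3 Ch. IX §3.2, auxiliary step] -/
theorem differentiableAt_coneChartVec {v : Fin 3 → ℂ} (hv : v ∈ negCone Hc) :
    DifferentiableAt ℂ (coneChartVec T) v := by
  have h2 : (ti T *ᵥ v) 2 ≠ 0 := BallModel.ne_zero_of_Q_neg (Q_ti_mulVec_neg T hT hv)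
  have hlin : DifferentiableAt ℂ (fun w : Fin 3 → ℂ ↦ ti T *ᵥ w) v := by
    have : (fun w : Fin 3 → ℂ ↦ ti T *ᵥ w) =
        ⇑(LinearMap.toContinuousLinearMap (Matrix.mulVecLin (ti T))) := rfl
    rw [this]
    exact ContinuousLinearMap.differentiableAt _
  have hk : ∀ k : Fin 3, DifferentiableAt ℂ (fun w : Fin 3 → ℂ ↦ (ti T *ᵥ w) k) v := fun k ↦
    (differentiableAt_pi.1 hlin) k
  rw [differentiableAt_pi]
  intro i
  fin_cases i
  · have h01 := (hk 0).fun_mul ((hk 2).fun_inv h2)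
    simpa [coneChartVec, div_eq_mul_inv] using h01
  · have h11 := (hk 1).fun_mul ((hk 2).fun_inv h2)
    simpa [coneChartVec, div_eq_mul_inv] using h11

end ConeChart

/-! ## 2. Holomorphy glue: manifold-differentiability on the ball versus differentiability in `ℂ²` -/

section Glue

/-- The chart of the ball `𝔹² ⊂ ℂ²` as an open partial homeomorphism (the one chart of
`BallModel.instChartedSpaceBall`). [cite: BergeronMillsonMoeglin2016Balls, Part 2 §1.3, auxiliary construction] -/
abbrev ballChart : OpenPartialHomeomorph Ball (Fin 2 → ℂ) :=
  BallModel.isOpenEmbedding_coe.toOpenPartialHomeomorph (fun z : Ball ↦ (z.1 : Fin 2 → ℂ))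

/-- **Holomorphic functions on the ball manifold are complex differentiable in coordinates**: if
`k : 𝔹² → ℂ` is manifold-differentiable at `z`, then `k ∘ chart⁻¹ : ℂ² → ℂ` is differentiable at `z`.
 [cite: Shafarevich1994, Book 3 Ch. IX §3.2, auxiliary step] -/
theorem differentiableAt_comp_ballChart_symm {k : Ball → ℂ} {z : Ball}
    (hk : MDifferentiableAt 𝓘(ℂ, Fin 2 → ℂ) 𝓘(ℂ, ℂ) k z) :
    DifferentiableAt ℂ (k ∘ ballChart.symm) (z.1 : Fin 2 → ℂ) := by
  have hsymm : MDifferentiableWithinAt 𝓘(ℂ, Fin 2 → ℂ) 𝓘(ℂ, Fin 2 → ℂ) ballChart.symm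
      (range fun z : Ball ↦ (z.1 : Fin 2 → ℂ)) (z.1 : Fin 2 → ℂ) :=
    ((contMDiffOn_isOpenEmbedding_symm (I := 𝓘(ℂ, Fin 2 → ℂ)) (n := ω) BallModel.isOpenEmbedding_coe)
      _ (mem_range_self z)).mdifferentiableWithinAt (by simp)
  have hz : ballChart.symm (z.1 : Fin 2 → ℂ) = z :=
    BallModel.isOpenEmbedding_coe.toOpenPartialHomeomorph_left_inv (fun z : Ball ↦ (z.1 : Fin 2 → ℂ))
  have hcomp : MDifferentiableWithinAt 𝓘(ℂ, Fin 2 → ℂ) 𝓘(ℂ, ℂ) (k ∘ ballChart.symm)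
      (range fun z : Ball ↦ (z.1 : Fin 2 → ℂ)) (z.1 : Fin 2 → ℂ) :=
    MDifferentiableAt.comp_mdifferentiableWithinAt _ (by rw [hz]; exact hk) hsymm
  have hnhds : (range fun z : Ball ↦ (z.1 : Fin 2 → ℂ)) ∈ 𝓝 (z.1 : Fin 2 → ℂ) :=
    BallModel.isOpenEmbedding_coe.isOpen_range.mem_nhds (mem_range_self z)
  exact mdifferentiableAt_iff_differentiableAt.1 (hcomp.mdifferentiableAt hnhds)

end Glue

end Literature.AlgebraicGeometry.ShimuraVarieties.FramedCone

end
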